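import Mathlib.Geometry.Manifold.SmoothEmbedding
import Mathlib.Geometry.Manifold.ContMDiff.Atlas
import Mathlib.Geometry.Manifold.ContMDiff.NormedSpace
import Mathlib.Geometry.Manifold.MFDeriv.Basic
import Literature.Geometry.Manifold.OpenSubmanifoldMFDeriv
import HarnessLib

/-!
# The inverse of a smooth embedding is smooth on its range

Topic `Literature/Geometry/Manifold` (namespace `Literature.Geometry.Manifold`). For a `C^n`
smooth embedding `f : M → N` in Mathlib's sense (`Manifold.IsSmoothEmbedding I J n f`: an
immersion in the chart sense — near every point `f` reads `u ↦ equiv (u, 0)` in charts of the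
maximal atlases — which is a topological embedding) we prove that the set-theoretic inverse
`Function.invFun f : N → M` is `C^n` **on `range f`** (as a map from the manifold `N`, possibly
of larger dimension, possibly with boundary, to `M`): in the immersion charts `φ`, `χ` at `x`,
`f⁻¹ = φ⁻¹ ∘ pr₁ ∘ equiv⁻¹ ∘ χ` on `f(φ.source)`, a neighbourhood of `f x` within `range f`.

* `contMDiffWithinAt_invFun_of_isImmersionAt` — pointwise version at an injective inducing map
  which is an immersion at `x`;
* `contMDiffOn_invFun_range` — `ContMDiffOn J I n (invFun f) (range f)` for a smooth embedding;
* `contMDiff_invFun_comp_subtype_val` — for an open set `U ⊆ range f` of `N`, the inverse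
  `U → M` is `C^n` on the open submanifold `U`;
* `injective_mfderiv_invFun_comp_subtype_val` — and its differential is injective at every point
  (from `f ∘ f⁻¹ = Subtype.val` and `mfderiv Subtype.val = id`,
  `Literature.Geometry.Manifold.OpenSubmanifold.mfderiv_subtype_val`).

Use (layer L0/L7 of the proof programme of `Literature.Geometry.Riemannian.BaerHankePscGluing`,
Bär–Hanke §4.4): for a gluing `P = M ∪_φ N` (`Literature.Topology.FourManifolds.IsBoundaryGluing`,
pieces `jM`, `jN`), the open piece `U = (range jN)ᶜ = jM(Int M)` of `P` carries the smooth local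
inverse `jM⁻¹ : U → M` with injective differential, along which a metric on `M` is transported to
`U` by `PseudoRiemannianMetric.comap` with `scalarCurvature_comap`. Lee, *Introduction to Smooth
Manifolds* (2013), Prop. 5.2 ff. / Thm. 4.14 (local form of immersions), Prop. 4.22 ff. (smooth
embeddings are diffeomorphisms onto their images).

Everything is proved; no definitions and no named facts are introduced.

## References

* J. M. Lee, *Introduction to Smooth Manifolds*, 2nd ed., GTM 218, Springer 2013, Ch. 4–5
  (rank theorem, embeddings, embedded submanifolds). [LeeSmoothManifolds2013]
-/

open scoped Manifold ContDiff Topology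
open Set Function

noncomputable section

namespace Literature.Geometry.Manifold

universe u

section General

variable {𝕜 : Type*} [NontriviallyNormedField 𝕜]
  {E : Type*} {E'' : Type u} [NormedAddCommGroup E] [NormedSpace 𝕜 E]
  [NormedAddCommGroup E''] [NormedSpace 𝕜 E'']
  {H : Type*} [TopologicalSpace H] {G : Type*} [TopologicalSpace G]
  {I : ModelWithCorners 𝕜 E H} {J : ModelWithCorners 𝕜 E'' G}
  {M : Type*} [TopologicalSpace M] [ChartedSpace H M]
  {N : Type*} [TopologicalSpace N] [ChartedSpace G N] {n : ℕ∞ω}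

/-- **The inverse of an injective immersion is smooth on the range, pointwise.** If `f : M → N`
is injective and inducing (a topological embedding) and is a `C^n` immersion at `x` in Mathlib's
chart sense, then `invFun f` is `C^n` within `range f` at `f x`: in the immersion charts
`φ = domChart`, `χ = codChart` with `χ ∘ f ∘ φ⁻¹ = equiv ∘ (·, 0)`, one has
`f⁻¹ = φ⁻¹ ∘ pr₁ ∘ equiv⁻¹ ∘ χ` on `f(φ.source)`, which is a neighbourhood of `f x` within
`range f`. Lee (2013), Thm. 4.14 / Prop. 4.22. [cite: LeeSmoothManifolds2013, Thm. 4.14 and Prop. 4.22] -/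
theorem contMDiffWithinAt_invFun_of_isImmersionAt [Nonempty M] {f : M → N} (hinj : Injective f)
    (hind : Topology.IsInducing f) {x : M} (h : Manifold.IsImmersionAt I J n f x) :
    ContMDiffWithinAt J I n (invFun f) (range f) (f x) := by
  classical
  set φ := h.domChart with hφdef
  set χ := h.codChart with hχdef
  have hx : x ∈ φ.source := h.mem_domChart_source
  have hfx : f x ∈ χ.source := h.mem_codChart_source
  have hφ : φ ∈ IsManifold.maximalAtlas I n M := h.domChart_mem_maximalAtlas
  have hχ : χ ∈ IsManifold.maximalAtlas J n N := h.codChart_mem_maximalAtlas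
  have hwr : EqOn ((χ.extend J) ∘ f ∘ (φ.extend I).symm) (h.equiv ∘ (·, 0))
      (φ.extend I).target := h.writtenInCharts
  -- the linear part `A = pr₁ ∘ equiv⁻¹ : E'' → E`
  set A : E'' →L[𝕜] E :=
    (ContinuousLinearMap.fst 𝕜 E h.complement).comp (h.equiv.symm : E'' →L[𝕜] E × h.complement)
    with hAdef
  -- the explicit local inverse `g = φ⁻¹ ∘ A ∘ χ`
  set g : N → M := fun p ↦ (φ.extend I).symm (A (χ.extend J p)) with hgdef
  have hsrc : ∀ y ∈ φ.source, y ∈ (φ.extend I).source := fun y hy ↦ by rwa [φ.extend_source]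
  -- in charts: `A (χ (f y)) = φ y` for `y ∈ φ.source`
  have hkey : ∀ y ∈ φ.source, A (χ.extend J (f y)) = φ.extend I y := by
    intro y hy
    have hy' : φ.extend I y ∈ (φ.extend I).target := (φ.extend I).map_source (hsrc y hy)
    have h1 := hwr hy'
    simp only [Function.comp_apply, (φ.extend I).left_inv (hsrc y hy)] at h1
    rw [hAdef, ContinuousLinearMap.comp_apply, h1]
    simp
  have hg : ∀ y ∈ φ.source, g (f y) = y := fun y hy ↦ by
    simp only [hgdef, hkey y hy]
    exact (φ.extend I).left_inv (hsrc y hy)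
  -- `invFun f = g` on the neighbourhood `f '' φ.source` of `f x` within `range f`
  have heq : EqOn (invFun f) g (f '' φ.source) := by
    rintro _ ⟨y, hy, rfl⟩
    rw [leftInverse_invFun hinj y, hg y hy]
  have hnhds : f '' φ.source ∈ 𝓝[range f] (f x) :=
    hind.image_mem_nhdsWithin (φ.open_source.mem_nhds hx)
  -- smoothness of `g`
  have hinner : ContMDiffAt J 𝓘(𝕜, E) n (fun p ↦ A (χ.extend J p)) (f x) :=
    A.contMDiff.contMDiffAt.comp (f x) (χ.contMDiffAt_extend hχ hfx)
  have htarget : ∀ y ∈ φ.source, φ.extend I y ∈ I '' φ.target := fun y hy ↦ by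
    rw [← φ.extend_target']
    exact (φ.extend I).map_source (hsrc y hy)
  have houter : ContMDiffWithinAt 𝓘(𝕜, E) I n (φ.extend I).symm (I '' φ.target)
      (A (χ.extend J (f x))) := by
    rw [hkey x hx]
    exact contMDiffOn_extend_symm hφ _ (htarget x hx)
  have hmaps : MapsTo (fun p ↦ A (χ.extend J p)) (f '' φ.source) (I '' φ.target) := by
    rintro _ ⟨y, hy, rfl⟩
    show A (χ.extend J (f y)) ∈ I '' φ.target
    rw [hkey y hy]
    exact htarget y hy
  have hgs : ContMDiffWithinAt J I n g (f '' φ.source) (f x) :=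
    houter.comp (f x) hinner.contMDiffWithinAt hmaps
  refine (hgs.mono_of_mem_nhdsWithin hnhds).congr_of_eventuallyEq
    (Filter.eventuallyEq_of_mem hnhds heq) ?_
  rw [leftInverse_invFun hinj x, hg x hx]

/-- **The inverse of a smooth embedding is smooth on its range**: for a `C^n` smooth embedding
`f : M → N` (Mathlib's `Manifold.IsSmoothEmbedding`), `invFun f : N → M` is `C^n` on `range f`.
Lee (2013), Prop. 4.22 ff. (a smooth embedding is a diffeomorphism onto its image).
[cite: LeeSmoothManifolds2013, Prop. 4.22] -/
theorem contMDiffOn_invFun_range [Nonempty M] {f : M → N}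
    (hf : Manifold.IsSmoothEmbedding I J n f) : ContMDiffOn J I n (invFun f) (range f) := by
  rintro _ ⟨x, rfl⟩
  exact contMDiffWithinAt_invFun_of_isImmersionAt hf.isEmbedding.injective
    hf.isEmbedding.isInducing (hf.isImmersion.isImmersionAt x)

/-- On an open subset `U ⊆ range f` of the target, the inverse of a smooth embedding `f` is a
`C^n` map `U → M` of the open submanifold `U`. Lee (2013), Prop. 4.22 and Example 1.26 (open
submanifolds). [cite: LeeSmoothManifolds2013, Prop. 4.22] -/
theorem contMDiff_invFun_comp_subtype_val [Nonempty M] {f : M → N}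
    (hf : Manifold.IsSmoothEmbedding I J n f) {U : TopologicalSpace.Opens N}
    (hU : (U : Set N) ⊆ range f) :
    ContMDiff J I n (invFun f ∘ (Subtype.val : U → N)) :=
  ((contMDiffOn_invFun_range hf).mono hU).comp_contMDiff contMDiff_subtype_val fun u ↦ u.2

omit [TopologicalSpace M] [ChartedSpace H M] in
/-- The inverse composed with `f` is the inclusion: `f (invFun f u) = u` for `u ∈ U ⊆ range f`.
[folklore] -/
theorem apply_invFun_subtype_val [Nonempty M] {f : M → N} {U : TopologicalSpace.Opens N}
    (hU : (U : Set N) ⊆ range f) (u : U) : f (invFun f u) = u :=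
  invFun_eq (hU u.2)

end General

section Real

variable {E : Type*} {E'' : Type u} [NormedAddCommGroup E] [NormedSpace ℝ E]
  [NormedAddCommGroup E''] [NormedSpace ℝ E'']
  {H : Type*} [TopologicalSpace H] {G : Type*} [TopologicalSpace G]
  {I : ModelWithCorners ℝ E H} {J : ModelWithCorners ℝ E'' G}
  {M : Type*} [TopologicalSpace M] [ChartedSpace H M]
  {N : Type*} [TopologicalSpace N] [ChartedSpace G N] {n : ℕ∞ω}

/-- **The inverse of a smooth embedding has injective differential** on an open subset
`U ⊆ range f` of the target: from `f ∘ f⁻¹ = Subtype.val` on `U` and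
`mfderiv Subtype.val = id` (`OpenSubmanifold.mfderiv_subtype_val`), the chain rule gives
`mfderiv f ∘ mfderiv f⁻¹ = id`, so `mfderiv f⁻¹` is injective (indeed `f⁻¹ : U → M` is a local
diffeomorphism when `dim M = dim N`). Requires `n ≠ 0` (differentiability). Lee (2013),
Prop. 4.22, Prop. 3.6 (chain rule). [cite: LeeSmoothManifolds2013, Prop. 4.22] -/
theorem injective_mfderiv_invFun_comp_subtype_val [Nonempty M] {f : M → N}
    (hf : Manifold.IsSmoothEmbedding I J n f) (hn : n ≠ 0) {U : TopologicalSpace.Opens N}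
    (hU : (U : Set N) ⊆ range f) (u : U) :
    Injective (mfderiv J I (invFun f ∘ (Subtype.val : U → N)) u) := by
  set Φ : U → M := invFun f ∘ (Subtype.val : U → N) with hΦ
  have hΦd : MDifferentiableAt J I Φ u :=
    (contMDiff_invFun_comp_subtype_val hf hU u).mdifferentiableAt hn
  have hfd : MDifferentiableAt I J f (Φ u) :=
    (hf.contMDiff (Φ u)).mdifferentiableAt hn
  have hcomp : f ∘ Φ = (Subtype.val : U → N) := funext fun v ↦ apply_invFun_subtype_val hU v
  have hchain : mfderiv J J (f ∘ Φ) u = (mfderiv I J f (Φ u)).comp (mfderiv J I Φ u) :=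
    mfderiv_comp u hfd hΦd
  rw [hcomp, OpenSubmanifold.mfderiv_subtype_val] at hchain
  have hleft : ∀ z : TangentSpace J u, (mfderiv I J f (Φ u)) ((mfderiv J I Φ u) z) = z :=
    fun z ↦ (DFunLike.congr_fun hchain z).symm
  intro v w hvw
  rw [← hleft v, ← hleft w, hvw]

end Real

end Literature.Geometry.Manifold

end
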